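import Summits.PneNP.PneNP.Theorems.ChebyshevTracialDesignRungAssembly
import Summits.PneNP.PneNP.Theorems.ChebyshevTracialDesignUnconditionalRungs
import Summits.PneNP.PneNP.Theorems.ChebyshevTracialDesignDimensionOne
import HarnessLib

/-!
# Cell pnp-psdrank, route `ChebyshevTracialDesign`: the tight-free `r = 1` rung is TWO-SIDED — `|Σ_{A×B} W| ≤ e^{−a·dq n}` on every tight-free
# rectangle, unconditionally — hence every SIGNED weighted rectangle with tight-free support is free (crux `TracialDecayExp20`, stmt-PneNP-19878)

Brick 173a (prover g34; MEMO-37 §1). The tree exports the `r = 1` rung one-sidedly (`…UnconditionalRungs.rectangleDecayExp_holds`: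
`Σ_{A×B} W ≤ e^{−a·dq n}` on tight-free rectangles; `…rectangleDecayExp_all_holds`: `≤ 20e^{−a·dq n}` on all rectangles), although brick 32's
assembly lemma `…RungAssembly.abs_value_le_three_terms` bounds the ABSOLUTE value of a tight-free rectangle (remainder by the column marginal,
crossing cells by the two-sided crossing-pin lemma, non-crossing spread cells EMPTY by SNT). On ALL rectangles no two-sided bound can hold
(`Σ_{all} W = Σ_c w_c = −1`); on tight-free ones it does, and two-sided smallness — unlike one-sided — survives SIGNED linear combinations,
which is what the sign-cancellation difficulty of the amplitude-one programme ((CG_1′)/(PC)/(PC-ν), bricks 98–172, MEMO-36 §2) is about.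
This file exports the two-sided rung and its weighted/signed forms; the companion brick 173b (`…SupportTightStrategies`) draws the consequences
for second moments of edge-type fields and for support-tight psd strategies of every dimension.
* §1 **`abs_rectangleDecayExp_of_globalLevelD`** / **`abs_rectangleDecayExp_holds`** — for some `a > 0` and all large even `n`, every
  balanced exact design of degree `dq n` with `Σ|w| ≤ 20` and every TIGHT-FREE rectangle: `|Σ_{U∈A} Σ_{M∈B} W(U,M)| ≤ e^{−a·dq n}`
  (unconditional via `GlobalLevelDInequality_holds`; the proof is brick 32's, verbatim up to its last line `x ≤ |x|`).
* §2 (design-free: any `W` whose tight-free rectangles have `|mass| ≤ γ`) **`abs_sum_mul_mul_le_of_tightFree`** — `|Σ_{U,M} W g(U)h(M)| ≤ γ`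
  for `g, h ∈ [0,1]` with TIGHT-FREE SUPPORT (`cc(U,M) = 1 ⇒ g(U) = 0 ∨ h(M) = 0`; greedy rounding of brick `…DimensionOne` inside the support,
  applied to `W` and to `−W`); **`abs_sum_mul_mul_le_of_tightFree_signed`** — `≤ 4γ` for SIGNED `|g|, |h| ≤ 1` (four sign parts);
* §3 the design corollary **`weighted_tightFree_decay`** (`|Σ W g h| ≤ 4e^{−a·dq n}`, unconditional).
[cite: Rothvoss2017, §2 and Lemma 7 (PDF pp. 6–8)] [cite: KupavskiiZakharov2022, Lemma 11] [cite: KeevashLifshitz2023, Thm. 1.8]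
Stature: support/instrument (kernel lane, no defs, axioms standard; §1 re-exports brick 32's bound with the absolute value it already proved;
§§2–3 are bookkeeping). WHAT THIS IS NOT: nothing on rectangles meeting the tight pairs (one-sided only, `rectangleDecayExp_all_holds`), no proof
or refutation of `TracialDecayExp20`, nothing on psd rank of P_PM(K_n) beyond the rungs, no P-vs-NP content. Supports stmt-PneNP-19878.
-/

set_option linter.dupNamespace false -- `Summit.PneNP.PneNP.…`: summit = sub-problem (D-0017)

noncomputable section

namespace Summit.PneNP.PneNP.Theorems.ChebyshevTracialDesignTightFreeTwoSided

open Finset Matrix Literature.Combinatorics.Optimization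
open Literature.Barriers.PneNP hiding verts
open Literature.Combinatorics.SetFamily
open Literature.Combinatorics.AssociationSchemes.HomogeneousMatchingFamilies
open Literature.Combinatorics.Additive.KeevashLifshitz
open Summit.PneNP.PneNP.Theorems.ChebyshevTracialDesignRungAssembly (levelWeight_eq_zero_of_card_ne abs_value_le_three_terms)
open Summit.PneNP.PneNP.Theorems.ChebyshevTracialDesignSpectralNonTightnessEstimates (atten_le_pow atten_nonneg)
open Summit.PneNP.PneNP.Theorems.ChebyshevTracialDesignSpectralNonTightnessWide (snt_sym_oddSet_of_globalLevelD)
open Summit.PneNP.PneNP.Theorems.ChebyshevTracialDesignRungConstants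
open Summit.PneNP.PneNP.Theorems.ChebyshevTracialDesignDimensionOne (sum_box_le_rectangle)

variable {n : ℕ}

/-! ### §1 The tight-free `r = 1` rung with the absolute value -/

/-- **THE TIGHT-FREE `r = 1` RUNG IS TWO-SIDED (modulo Keevash–Lifshitz Thm 1.8).** Assume `GlobalLevelDInequality`. Then there are `a > 0` and
`n₁` such that for every even `n ≥ n₁`, every balanced exact design `(t, C, w)` of degree `dq n` on levels `≤ Tq n` with `Σ_c |w_c| ≤ 20`, and
every tight-free rectangle `A × B` of odd cuts and perfect matchings of `K_n`: `|Σ_{U∈A} Σ_{M∈B} W(U,M)| ≤ exp(−a·dq n)`. The proof is brick 32's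
(`…RungAssembly.rectangleDecayExp_of_globalLevelD`) with its last weakening `x ≤ |x|` removed: the three-term lemma `abs_value_le_three_terms`
bounds the absolute value. [cite: Rothvoss2017, §2 and Lemma 7 (PDF pp. 6–8)] [cite: KupavskiiZakharov2022, Lemma 11] [cite: KeevashLifshitz2023, Thm. 1.8] -/
theorem abs_rectangleDecayExp_of_globalLevelD (hKL : GlobalLevelDInequality) :
    ∃ a : ℝ, 0 < a ∧ ∃ n₁ : ℕ, ∀ n : ℕ, n₁ ≤ n → Even n → ∀ (t : ℕ) (C : Finset ℕ) (w : ℕ → ℝ),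
      IsBalancedDesign n t (Tq n) (dq n) 20 C w →
        ∀ (A : Finset (OddSet n)) (B : Finset (PMatch n)), (∀ U ∈ A, ∀ M ∈ B, cc U M ≠ 1) →
          |∑ U ∈ A, ∑ M ∈ B, levelWeight n t C w U M| ≤ Real.exp (-(a * (dq n : ℝ))) := by
  classical
  have hτ1 : (1 : ℝ) ≤ Real.exp 1 := by have := Real.add_one_le_exp (1 : ℝ); linarith
  have hτ0 : (0 : ℝ) < Real.exp 1 := Real.exp_pos 1
  obtain ⟨c₁, hc₁, N₁, hS⟩ := snt_sym_oddSet_of_globalLevelD hKL hτ1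
  obtain ⟨c₀, hc₀def⟩ : ∃ c₀ : ℝ, c₀ = min c₁ 1 := ⟨_, rfl⟩
  have hc₀ : 0 < c₀ := by rw [hc₀def]; exact lt_min hc₁ one_pos
  have hc₀1 : c₀ ≤ 1 := by rw [hc₀def]; exact min_le_right _ _
  have hc₀c₁ : c₀ ≤ c₁ := by rw [hc₀def]; exact min_le_left _ _
  -- SNT at threshold `c₀`
  have hSNT : ∀ (m t : ℕ), N₁ ≤ m → Even m → Odd t → m ≤ 5 * t → m ≤ 5 * (m - t) →
      ∀ (X : Finset (OddSet m)), (∀ U ∈ X, U.1.card = t) →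
      ∀ (Y' : Finset (PMatch m)), IsRelHomogeneous (Real.exp 1) (perfectMatchings (univ : Finset (Fin m))) (Y'.image Subtype.val) →
      Real.exp (-(c₀ * dq m)) ≤ (X.card : ℝ) / (m.choose t : ℝ) →
      Real.exp (-(c₀ * dq m)) ≤ (Y'.card : ℝ) / (Fintype.card (PMatch m) : ℝ) → ∃ U ∈ X, ∃ M ∈ Y', cc U M = 1 := by
    intro m t h1 h2 h3 h4 h5 X hX Y' hY' hdX hdY
    have hmono : Real.exp (-(c₁ * dq m)) ≤ Real.exp (-(c₀ * dq m)) :=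
      Real.exp_le_exp.2 (by nlinarith [Nat.cast_nonneg (α := ℝ) (dq m)])
    exact hS m t h1 h2 h3 h4 h5 X hX Y' hY' (hmono.trans hdX) (hmono.trans hdY)
  obtain ⟨a, ha⟩ : ∃ a : ℝ, a = c₀ / 80 := ⟨_, rfl⟩
  have ha0 : 0 < a := by rw [ha]; positivity
  obtain ⟨D₁, hD₁⟩ : ∃ D₁ : ℕ, D₁ = max 500 ⌈16 / c₀⌉₊ := ⟨_, rfl⟩
  refine ⟨a, ha0, max (2 * N₁ + 8) (D₁ ^ 4), ?_⟩
  intro n hn hev t C w hdes A B hAB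
  obtain ⟨hex, hbal⟩ := hdes
  obtain ⟨c', rfl⟩ := hex.1
  -- the size parameter `D = dq n`
  have hN₁ : 2 * N₁ + 8 ≤ n := le_trans (le_max_left _ _) hn
  have hD₁n : D₁ ^ 4 ≤ n := le_trans (le_max_right _ _) hn
  have hD : D₁ ≤ dq n := by
    unfold dq
    rw [Nat.le_sqrt, Nat.le_sqrt]
    calc D₁ * D₁ * (D₁ * D₁) = D₁ ^ 4 := by ring
      _ ≤ n := hD₁n
  have hD500 : 500 ≤ dq n := le_trans (by rw [hD₁]; exact le_max_left _ _) hD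
  have hDc : ⌈16 / c₀⌉₊ ≤ dq n := le_trans (by rw [hD₁]; exact le_max_right _ _) hD
  have hcD : 16 ≤ c₀ * dq n := by
    have h1 : 16 / c₀ ≤ (dq n : ℝ) := (Nat.le_ceil _).trans (by exact_mod_cast hDc)
    rwa [div_le_iff₀ hc₀, mul_comm] at h1
  have hD4n : dq n ^ 4 ≤ n := by
    have h1 : dq n * dq n ≤ Nat.sqrt n := Nat.sqrt_le (Nat.sqrt n)
    calc dq n ^ 4 = (dq n * dq n) * (dq n * dq n) := by ring
      _ ≤ Nat.sqrt n * Nat.sqrt n := Nat.mul_le_mul h1 h1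
      _ ≤ n := Nat.sqrt_le n
  have hD2 : dq n * dq n ≤ dq n ^ 4 := by
    calc dq n * dq n = dq n * dq n * 1 := (mul_one _).symm
      _ ≤ dq n * dq n * (dq n * dq n) := Nat.mul_le_mul_left _ (Nat.one_le_iff_ne_zero.2 (by positivity))
      _ = dq n ^ 4 := by ring
  have h500D : 500 * dq n ≤ n := by nlinarith
  have hnD : n < (dq n + 1) ^ 4 := by
    have h1 := Nat.lt_succ_sqrt' n
    have h2 := Nat.lt_succ_sqrt' (Nat.sqrt n)
    have h3 : Nat.sqrt n + 1 ≤ (dq n + 1) ^ 2 := h2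
    calc n < (Nat.sqrt n + 1) ^ 2 := h1
      _ ≤ ((dq n + 1) ^ 2) ^ 2 := Nat.pow_le_pow_left h3 2
      _ = (dq n + 1) ^ 4 := by ring
  have hn16 : (n : ℝ) ≤ 16 * (dq n : ℝ) ^ 4 := by
    have h1 : n ≤ (2 * dq n) ^ 4 := hnD.le.trans (Nat.pow_le_pow_left (by omega) 4)
    have h2 : ((n : ℕ) : ℝ) ≤ (((2 * dq n) ^ 4 : ℕ) : ℝ) := by exact_mod_cast h1
    have h3 : (((2 * dq n) ^ 4 : ℕ) : ℝ) = 16 * (dq n : ℝ) ^ 4 := by push_cast; ring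
    linarith
  -- the core size `q`
  obtain ⟨q, hq⟩ : ∃ q : ℕ, q = ⌈a * dq n⌉₊ + 4 := ⟨_, rfl⟩
  have hq1 : a * dq n + 5 ≤ (q : ℝ) + 1 := by
    rw [hq]; push_cast; linarith [Nat.le_ceil (a * dq n)]
  have hq2 : (q : ℝ) + 1 ≤ a * dq n + 6 := by
    rw [hq]; push_cast
    have := Nat.ceil_lt_add_one (show 0 ≤ a * dq n by positivity); linarith
  have hq80 : 80 * q < dq n + 480 := by
    have hcd : c₀ * dq n ≤ dq n := by nlinarith [Nat.cast_nonneg (α := ℝ) (dq n)]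
    have h1 : (80 : ℝ) * q < dq n + 480 := by rw [ha] at hq2; linarith
    exact_mod_cast h1
  have hq40 : 40 * q ≤ n := by omega
  have h2q : 2 * q ≤ dq n := by omega
  have hN₁q : N₁ + 2 * q ≤ n := by omega
  have hκ : 18 * q + 18 ≤ (dq n - 4) / 2 + 1 := by omega
  have hn1 : 1 ≤ n := by omega
  -- the design degree
  have hDg : dq n ≤ 2 * c' := by
    have h1 : Tq n ≤ 2 * c' + 1 := hex.2.2.1
    have h2 : dq n ≤ Nat.sqrt n := Nat.sqrt_le_self _
    unfold Tq at h1; omega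
  have hDg4 : 4 ≤ dq n := by omega
  -- the spread approximation of the matching side
  obtain ⟨Dk⟩ := exists_spreadApproximation (image_val_subset B) hτ1 q
  -- the junk threshold `β = exp(−c₀(D−1))`
  have hβ : ∀ m : ℕ, n ≤ m + 2 * q → m ≤ n → Real.exp (-(c₀ * dq m)) ≤ Real.exp (-(c₀ * ((dq n : ℝ) - 1))) := by
    intro m hm1 _
    have hdm : dq n - 1 ≤ dq m := by
      have h1 : (dq n - 1) ^ 4 + dq n ≤ dq n ^ 4 := pred_pow_four_add_le (by omega)
      have h2 : (dq n - 1) ^ 4 ≤ m := by omega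
      show dq n - 1 ≤ Nat.sqrt (Nat.sqrt m)
      rw [Nat.le_sqrt, Nat.le_sqrt]
      calc (dq n - 1) * (dq n - 1) * ((dq n - 1) * (dq n - 1)) = (dq n - 1) ^ 4 := by ring
        _ ≤ m := h2
    apply Real.exp_le_exp.2
    have h3 : ((dq n : ℝ) - 1) ≤ (dq m : ℝ) := by
      have : ((dq n - 1 : ℕ) : ℝ) ≤ dq m := by exact_mod_cast hdm
      rwa [Nat.cast_sub (by omega), Nat.cast_one] at this
    nlinarith
  -- reduce `A` to the `t`-cuts
  have hAeq : ∑ U ∈ A, ∑ M ∈ B, levelWeight n (2 * c' + 1) C w U M =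
      ∑ U ∈ A.filter (fun U => U.1.card = 2 * c' + 1), ∑ M ∈ B, levelWeight n (2 * c' + 1) C w U M := by
    rw [sum_filter]
    refine sum_congr rfl fun U _ => ?_
    split_ifs with hU
    · rfl
    · exact sum_eq_zero fun M _ => levelWeight_eq_zero_of_card_ne C w hU M
  have hAtcard : ∀ U ∈ A.filter (fun U => U.1.card = 2 * c' + 1), U.1.card = 2 * c' + 1 := fun U hU => (mem_filter.1 hU).2
  have hAtB : ∀ U ∈ A.filter (fun U => U.1.card = 2 * c' + 1), ∀ M ∈ B, cc U M ≠ 1 :=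
    fun U hU M hM => hAB U (mem_filter.1 hU).1 M hM
  -- the three-term bound (absolute value)
  have h3 := abs_value_le_three_terms hev hn1 hex hDg hDg4 hbal hq40 hN₁q hτ0 hSNT hβ (Real.exp_pos _).le
    (A.filter fun U => U.1.card = 2 * c' + 1) hAtcard B hAtB Dk
  -- the attenuation `P_{D−4} ≤ (2/D³)^κ`
  have hκn : 4 * ((dq n - 4) / 2 + 1) ≤ n := by omega
  have hκ2D : 4 * ((dq n - 4) / 2 + 1) ≤ 2 * dq n := by omega
  have hP := atten_le_pow (n := n) hκn
  have hDpos : (0 : ℝ) < dq n := by exact_mod_cast (show 0 < dq n by omega)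
  have hn0 : (0 : ℝ) < n := by exact_mod_cast (show 0 < n by omega)
  have hD4R : (dq n : ℝ) ^ 4 ≤ n := by exact_mod_cast hD4n
  have hratio : (4 * (((dq n - 4) / 2 + 1 : ℕ) : ℝ)) / n ≤ 2 / (dq n : ℝ) ^ 3 := by
    rw [div_le_div_iff₀ hn0 (by positivity)]
    have h1 : (4 * (((dq n - 4) / 2 + 1 : ℕ) : ℝ)) ≤ 2 * dq n := by exact_mod_cast hκ2D
    calc 4 * (((dq n - 4) / 2 + 1 : ℕ) : ℝ) * (dq n : ℝ) ^ 3 ≤ 2 * dq n * (dq n : ℝ) ^ 3 :=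
          mul_le_mul_of_nonneg_right h1 (by positivity)
      _ = 2 * (dq n : ℝ) ^ 4 := by ring
      _ ≤ 2 * n := by linarith
  have hP0 : 0 ≤ ∏ i ∈ range ((dq n - 4) / 2 + 1), ((2 * i + 1 : ℝ) / ((n : ℝ) - 2 * i)) := atten_nonneg (by omega)
  have hP2 := hP.trans (pow_le_pow_left₀ (by positivity) hratio _)
  have hP' : (∏ i ∈ range ((dq n - 4) / 2 + 1), ((2 * i + 1 : ℝ) / ((n : ℝ) - 2 * i))) * (dq n : ℝ) ^ (3 * ((dq n - 4) / 2 + 1)) ≤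
      (2 : ℝ) ^ ((dq n - 4) / 2 + 1) := by
    calc _ ≤ (2 / (dq n : ℝ) ^ 3) ^ ((dq n - 4) / 2 + 1) * (dq n : ℝ) ^ (3 * ((dq n - 4) / 2 + 1)) :=
          mul_le_mul_of_nonneg_right hP2 (by positivity)
      _ = (2 : ℝ) ^ ((dq n - 4) / 2 + 1) := by
          rw [div_pow, ← pow_mul, div_mul_cancel₀]
          exact pow_ne_zero _ hDpos.ne'
  -- the three terms
  have hT1 := remainder_term_le hq1
  have hq2' : (q : ℝ) + 1 ≤ c₀ / 80 * dq n + 6 := by rw [ha] at hq2; exact hq2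
  have hT2 := junk_term_le (D := (dq n : ℝ)) hc₀1 hcD hq2'
  rw [← ha] at hT2
  have hT3 := crossing_term_le (a := a) hP0 hP' (by omega : 2 ≤ dq n) hn16 hκ (by linarith)
  rw [hAeq]
  refine h3.trans ?_
  linarith

/-- **THE TIGHT-FREE `r = 1` RUNG IS TWO-SIDED — UNCONDITIONAL** (Keevash–Lifshitz Thm 1.8 discharged by `GlobalLevelDInequality_holds`):
`|Σ_{U∈A} Σ_{M∈B} W(U,M)| ≤ exp(−a·dq n)` on every tight-free rectangle, for every balanced Chebyshev design.
[cite: Rothvoss2017, §2 and Lemma 7 (PDF pp. 6–8)] [cite: KeevashLifshitz2023, Thm. 1.8] [cite: KupavskiiZakharov2022, Lemma 11] -/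
theorem abs_rectangleDecayExp_holds :
    ∃ a : ℝ, 0 < a ∧ ∃ n₁ : ℕ, ∀ n : ℕ, n₁ ≤ n → Even n → ∀ (t : ℕ) (C : Finset ℕ) (w : ℕ → ℝ),
      IsBalancedDesign n t (Tq n) (dq n) 20 C w →
        ∀ (A : Finset (OddSet n)) (B : Finset (PMatch n)), (∀ U ∈ A, ∀ M ∈ B, cc U M ≠ 1) →
          |∑ U ∈ A, ∑ M ∈ B, levelWeight n t C w U M| ≤ Real.exp (-(a * (dq n : ℝ))) :=
  abs_rectangleDecayExp_of_globalLevelD GlobalLevelDInequality_holds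

/-! ### §2 Weighted and signed tight-free rectangles (design-free: any weight with two-sided tight-free bound `γ`) -/

/-- **Two-sided bound for [0,1]-WEIGHTED rectangles with tight-free support.** If every tight-free 0/1 rectangle has `|W-mass| ≤ γ`, then
`|Σ_{U,M} W(U,M) g(U) h(M)| ≤ γ` for all `g, h` with values in `[0,1]` such that `g(U)h(M)` vanishes on the tight pairs (greedy rounding of
brick `…DimensionOne` inside the support, applied to `W` and to `−W`). [cite: Rothvoss2017, §2 and Lemma 7 (PDF pp. 6–8)] -/
theorem abs_sum_mul_mul_le_of_tightFree (W : OddSet n → PMatch n → ℝ) {γ : ℝ}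
    (hR : ∀ (A : Finset (OddSet n)) (B : Finset (PMatch n)), (∀ U ∈ A, ∀ M ∈ B, cc U M ≠ 1) →
      |∑ U ∈ A, ∑ M ∈ B, W U M| ≤ γ)
    (g : OddSet n → ℝ) (h : PMatch n → ℝ) (hg : ∀ U, 0 ≤ g U ∧ g U ≤ 1) (hh : ∀ M, 0 ≤ h M ∧ h M ≤ 1)
    (hT : ∀ U M, cc U M = 1 → g U = 0 ∨ h M = 0) :
    |∑ U, ∑ M, W U M * (g U * h M)| ≤ γ := by
  classical
  have hT' : ∀ U M, cc U M = 1 → g U * h M = 0 := fun U M h1 => by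
    rcases hT U M h1 with h0 | h0 <;> simp [h0]
  rw [abs_le]
  constructor
  · obtain ⟨A, B, hAB, hle⟩ := sum_box_le_rectangle (fun U M => -W U M) (fun U M => cc U M = 1) g h hg hh hT'
    have h1 : ∑ U, ∑ M, -W U M * (g U * h M) = -∑ U, ∑ M, W U M * (g U * h M) := by
      simp only [neg_mul, sum_neg_distrib]
    have h2 : ∑ U ∈ A, ∑ M ∈ B, -W U M = -∑ U ∈ A, ∑ M ∈ B, W U M := by
      simp only [sum_neg_distrib]
    rw [h1, h2] at hle
    have h3 := (abs_le.1 (hR A B fun U hU M hM => hAB U hU M hM)).1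
    linarith
  · obtain ⟨A, B, hAB, hle⟩ := sum_box_le_rectangle W (fun U M => cc U M = 1) g h hg hh hT'
    exact hle.trans ((le_abs_self _).trans (hR A B fun U hU M hM => hAB U hU M hM))

/-- Positive part of a function with values in `[−1,1]` lies in `[0,1]`. -/
theorem posPart_mem {x : ℝ} (hx : |x| ≤ 1) : 0 ≤ max x 0 ∧ max x 0 ≤ 1 :=
  ⟨le_max_right _ _, max_le (abs_le.1 hx).2 zero_le_one⟩

/-- Negative part of a function with values in `[−1,1]` lies in `[0,1]`. -/
theorem negPart_mem {x : ℝ} (hx : |x| ≤ 1) : 0 ≤ max (-x) 0 ∧ max (-x) 0 ≤ 1 :=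
  ⟨le_max_right _ _, max_le (by linarith [(abs_le.1 hx).1]) zero_le_one⟩

/-- `x = x₊ − x₋`. -/
theorem posPart_sub_negPart (x : ℝ) : max x 0 - max (-x) 0 = x := by
  rcases le_total 0 x with h | h
  · rw [max_eq_left h, max_eq_right (by linarith), sub_zero]
  · rw [max_eq_right h, max_eq_left (by linarith)]; ring

/-- **Two-sided bound for SIGNED weighted rectangles with tight-free support**: `|g|, |h| ≤ 1`, `g(U)h(M) = 0` unless... precisely
`cc(U,M) = 1 ⇒ g(U) = 0 ∨ h(M) = 0`; then `|Σ_{U,M} W g h| ≤ 4γ` (split both factors into positive and negative parts).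
[cite: Rothvoss2017, §2 and Lemma 7 (PDF pp. 6–8)] -/
theorem abs_sum_mul_mul_le_of_tightFree_signed (W : OddSet n → PMatch n → ℝ) {γ : ℝ}
    (hR : ∀ (A : Finset (OddSet n)) (B : Finset (PMatch n)), (∀ U ∈ A, ∀ M ∈ B, cc U M ≠ 1) →
      |∑ U ∈ A, ∑ M ∈ B, W U M| ≤ γ)
    (g : OddSet n → ℝ) (h : PMatch n → ℝ) (hg : ∀ U, |g U| ≤ 1) (hh : ∀ M, |h M| ≤ 1)
    (hT : ∀ U M, cc U M = 1 → g U = 0 ∨ h M = 0) :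
    |∑ U, ∑ M, W U M * (g U * h M)| ≤ 4 * γ := by
  classical
  -- the four sign parts
  have hzero : ∀ {x : ℝ}, x = 0 → max x 0 = 0 ∧ max (-x) 0 = 0 := fun hx => by subst hx; simp
  have key : ∀ (g' : OddSet n → ℝ) (h' : PMatch n → ℝ), (∀ U, 0 ≤ g' U ∧ g' U ≤ 1) → (∀ M, 0 ≤ h' M ∧ h' M ≤ 1) →
      (∀ U, g U = 0 → g' U = 0) → (∀ M, h M = 0 → h' M = 0) → |∑ U, ∑ M, W U M * (g' U * h' M)| ≤ γ := by
    intro g' h' hg' hh' hg0 hh0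
    refine abs_sum_mul_mul_le_of_tightFree W hR g' h' hg' hh' fun U M h1 => ?_
    rcases hT U M h1 with h0 | h0
    · exact Or.inl (hg0 U h0)
    · exact Or.inr (hh0 M h0)
  have hpp := key (fun U => max (g U) 0) (fun M => max (h M) 0) (fun U => posPart_mem (hg U)) (fun M => posPart_mem (hh M))
    (fun U hU => (hzero hU).1) (fun M hM => (hzero hM).1)
  have hpn := key (fun U => max (g U) 0) (fun M => max (-h M) 0) (fun U => posPart_mem (hg U)) (fun M => negPart_mem (hh M))
    (fun U hU => (hzero hU).1) (fun M hM => (hzero hM).2)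
  have hnp := key (fun U => max (-g U) 0) (fun M => max (h M) 0) (fun U => negPart_mem (hg U)) (fun M => posPart_mem (hh M))
    (fun U hU => (hzero hU).2) (fun M hM => (hzero hM).1)
  have hnn := key (fun U => max (-g U) 0) (fun M => max (-h M) 0) (fun U => negPart_mem (hg U)) (fun M => negPart_mem (hh M))
    (fun U hU => (hzero hU).2) (fun M hM => (hzero hM).2)
  have hsplit : ∑ U, ∑ M, W U M * (g U * h M) =
      ∑ U, ∑ M, W U M * (max (g U) 0 * max (h M) 0) - ∑ U, ∑ M, W U M * (max (g U) 0 * max (-h M) 0)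
        - ∑ U, ∑ M, W U M * (max (-g U) 0 * max (h M) 0) + ∑ U, ∑ M, W U M * (max (-g U) 0 * max (-h M) 0) := by
    rw [← sum_sub_distrib, ← sum_sub_distrib, ← sum_add_distrib]
    refine sum_congr rfl fun U _ => ?_
    rw [← sum_sub_distrib, ← sum_sub_distrib, ← sum_add_distrib]
    refine sum_congr rfl fun M _ => ?_
    have key4 : ∀ (x a b c d : ℝ), x * ((a - b) * (c - d)) = x * (a * c) - x * (a * d) - x * (b * c) + x * (b * d) := by
      intros; ring
    have := key4 (W U M) (max (g U) 0) (max (-g U) 0) (max (h M) 0) (max (-h M) 0)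
    rwa [posPart_sub_negPart, posPart_sub_negPart] at this
  rw [hsplit]
  have habs : ∀ x y z u : ℝ, |x - y - z + u| ≤ |x| + |y| + |z| + |u| := by
    intro x y z u
    have h1 := abs_add_le (x - y - z) u
    have h2 := abs_sub (x - y) z
    have h3 := abs_sub x y
    linarith
  refine (habs _ _ _ _).trans ?_
  linarith [hpp, hpn, hnp, hnn]

/-! ### §3 Design corollary (unconditional) -/

/-- **Weighted tight-free rectangles of balanced Chebyshev designs — UNCONDITIONAL, two-sided**: `|Σ_{U,M} W g h| ≤ 4·e^{−a·dq n}` for signed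
`|g|, |h| ≤ 1` with tight-free support. [cite: Rothvoss2017, §2 and Lemma 7 (PDF pp. 6–8)] [cite: KeevashLifshitz2023, Thm. 1.8] -/
theorem weighted_tightFree_decay :
    ∃ a : ℝ, 0 < a ∧ ∃ n₁ : ℕ, ∀ n : ℕ, n₁ ≤ n → Even n → ∀ (t : ℕ) (C : Finset ℕ) (w : ℕ → ℝ),
      IsBalancedDesign n t (Tq n) (dq n) 20 C w →
        ∀ (g : OddSet n → ℝ) (h : PMatch n → ℝ), (∀ U, |g U| ≤ 1) → (∀ M, |h M| ≤ 1) →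
          (∀ U M, cc U M = 1 → g U = 0 ∨ h M = 0) →
          |∑ U, ∑ M, levelWeight n t C w U M * (g U * h M)| ≤ 4 * Real.exp (-(a * (dq n : ℝ))) := by
  obtain ⟨a, ha, n₁, hrung⟩ := abs_rectangleDecayExp_holds
  exact ⟨a, ha, n₁, fun n hn hev t C w hdes g h hg hh hT =>
    abs_sum_mul_mul_le_of_tightFree_signed _ (hrung n hn hev t C w hdes) g h hg hh hT⟩

end Summit.PneNP.PneNP.Theorems.ChebyshevTracialDesignTightFreeTwoSided
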